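import Mathlib
import Literature.MathematicalPhysics.QuantumLattice.WilsonDiracAP
import Summits.QuantumFields.QCD.Theorems.QuarksAsStableActionCriticalLineDiamagnetismStubCellGainTilingGlue

/-!
# Tiling form of the one-cell gain implies the gauged (crux-currency) form, `N` colours, `K` tracked
(helper for crux stmt-QuantumFields-9307 `FlatCellOptimal`, line `registered`, stub
`stub_localNormGain_of` (G4 transport), sub-goal `stub_cellGainTilingGlueAllN` — the `Fin 3 ↦ Fin N`,
K-TRACKED, NORM-form port of the sibling crux stmt-QuantumFields-9734's
`…CriticalLineDiamagnetismStubCellGainTilingGlue`, wave 12)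

What.  Glue `(cell gain, TILING currency) → (cell gain, CRUX currency)` of the all-`N` cell-gain chain
CellGainCore → CellRegauge → TilingGlue → CellGainOfGauged, POINTWISE and with the additive constant `K`
and the rate EXPLICIT: for every `K cg : ℝ`, every `N`, every half-side `M` (torus `(ℤ/2M)⁴`), every
mass `m`, the crux's `dAP` (antiperiodic determinant at mass `m`) and `dfc` (plaquette deficit) given by
their DEFINING EQUATIONS, every pair of `U(N)` fields `W` (the tiling) and `V` (the cell field) and every
plaquette Finset `CF`:
`‖det D_AP[W]‖ ≤ exp(K − cg · M⁴ · Σ_{p ∈ CF} (N − Re tr V_p)) · ‖det D_AP[𝟙]‖` (tiling currency: seam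
field `e ↦ if x_μ + 1 = 2M then −W e else W e`, free seam `e ↦ if x_μ + 1 = 2M then (−1 : U(N)) else 1`)
implies `‖dAP W‖ ≤ exp(K − (cg/4) · ((2M)⁴/4) · Σ_{p ∈ CF} dfc V p) · ‖dAP 1‖` (crux currency on
`L = 2M`: `L⁴/4 = 4M⁴`, rate `c := cg/4`, the SAME `K`; in the crux `K = 0`).  Used by the transport at
`W := tile_cell W'`, `CF :=` the cell plaquettes, after `L = 2M` (`Even L`, `subst`); the output is
literally the hypothesis shape of the landed `…CellGain.stub_cellGainOfGaugedAllN` (p162037).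

How.  `(cg/4) · ((2M)⁴/4) = cg · M⁴` (`exponent_eq`, `push_cast; ring`); `dAP W` unfolds by its
defining equation, and `dAP 1` is the free antiperiodic determinant because `(1 : GaugeConfig) e = 1`
definitionally (`apDet_one`); the two deficit sums agree termwise by the defining equation of `dfc`.
The sibling's `N`-free helpers (`filter_inst_congr`, the `Re`-form `glue_ineq`) are re-EXPORTED into
`…CellGain.CellGainTilingGlue` (aliases, no restatement).  References: folklore bookkeeping; K. G. Wilson,
Phys. Rev. D 10 (1974) 2445 (the lattice currency).  Pure theorem file (no definitions).
-/

noncomputable section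

open scoped BigOperators Classical Matrix ComplexConjugate
open Finset
open Literature.MathematicalPhysics.QuantumLattice Literature.MathematicalPhysics.QuantumFieldTheory
  Literature.Probability.LatticeModels

namespace Summit.QuantumFields.QCD.Cruxes.FlatCellOptimal.CellGain

namespace CellGainTilingGlue

/-! ### The sibling's `N`-free helpers, re-exported -/

export Summit.QuantumFields.QCD.Cruxes.CriticalLineDiamagnetism.ChessboardCellGain.StubCellGainTilingGlueAux
  (filter_inst_congr glue_ineq)

/-! ### Exponent arithmetic and the norm-form glue inequality -/

/-- `(cg/4) · ((2M)⁴/4) = cg · M⁴`. -/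
theorem exponent_eq (cg : ℝ) (M : ℕ) :
    cg / 4 * (((2 * M : ℕ) : ℝ) ^ 4 / 4) = cg * (M : ℝ) ^ 4 := by
  push_cast; ring

/-- The norm-form glue inequality (`K` tracked): from `‖A‖ ≤ exp(K − cg M⁴ S) ‖B‖` and `S = S'` to
`‖A‖ ≤ exp(K − (cg/4) ((2M)⁴/4) S') ‖B‖`. -/
theorem glue_ineq_norm {A B : ℂ} {K cg S S' : ℝ} {M : ℕ} (hS : S = S')
    (h : ‖A‖ ≤ Real.exp (K - cg * (M : ℝ) ^ 4 * S) * ‖B‖) :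
    ‖A‖ ≤ Real.exp (K - cg / 4 * (((2 * M : ℕ) : ℝ) ^ 4 / 4) * S') * ‖B‖ := by
  -- adapted from the sibling `StubCellGainTilingGlueAux.glue_ineq` (`Re ↦ ‖·‖`)
  rw [exponent_eq, ← hS]
  exact h

/-! ### The crux currency: `dAP` by its defining equation -/

variable {N L : ℕ} [NeZero L] {m : ℝ} {dAP : GaugeConfig 4 L (Matrix.unitaryGroup (Fin N) ℂ) → ℂ}

/-- **`dAP 1` is the free antiperiodic determinant**: the seam field of the trivial configuration is
`e ↦ if x_μ + 1 = L then (−1 : U(N)) else 1` (`(1 : GaugeConfig) e = 1` definitionally). -/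
theorem apDet_one
    (hdAP : ∀ V : GaugeConfig 4 L (Matrix.unitaryGroup (Fin N) ℂ), dAP V =
      (wilsonDirac (unitaryFundamentalRep (Fin N) ℂ)
        (fun e => if (e.1 e.2).val + 1 = L then -V e else V e) m 1).det) :
    dAP 1 = (wilsonDirac (unitaryFundamentalRep (Fin N) ℂ)
      (fun e : Edge 4 L => if (e.1 e.2).val + 1 = L then (-1 : Matrix.unitaryGroup (Fin N) ℂ) else 1)
      m 1).det := by
  rw [hdAP]
  rfl

/-- **The glue at a fixed field, `K` tracked** (`CellGainTilingGlue.glue`): tiling currency on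
`(ℤ/2M)⁴` ⇒ crux currency, for `dAP`, `dfc` given by their defining equations. -/
theorem glue {M : ℕ} [NeZero M] {K cg m : ℝ}
    {dAP : GaugeConfig 4 (2 * M) (Matrix.unitaryGroup (Fin N) ℂ) → ℂ}
    {dfc : GaugeConfig 4 (2 * M) (Matrix.unitaryGroup (Fin N) ℂ) → Plaquette 4 (2 * M) → ℝ}
    (hdAP : ∀ V : GaugeConfig 4 (2 * M) (Matrix.unitaryGroup (Fin N) ℂ), dAP V =
      (wilsonDirac (unitaryFundamentalRep (Fin N) ℂ)
        (fun e => if (e.1 e.2).val + 1 = 2 * M then -V e else V e) m 1).det)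
    (hdfc : ∀ (V : GaugeConfig 4 (2 * M) (Matrix.unitaryGroup (Fin N) ℂ)) (p : Plaquette 4 (2 * M)),
      dfc V p = (N : ℝ) - (unitaryFundamentalRep (Fin N) ℂ (plaquetteHolonomy V p.1 p.2.1.1 p.2.1.2)).trace.re)
    (W V : GaugeConfig 4 (2 * M) (Matrix.unitaryGroup (Fin N) ℂ)) (CF : Finset (Plaquette 4 (2 * M)))
    (h : ‖(wilsonDirac (unitaryFundamentalRep (Fin N) ℂ)
        (fun e => if (e.1 e.2).val + 1 = 2 * M then -(W e) else W e) m 1).det‖ ≤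
      Real.exp (K - cg * (M : ℝ) ^ 4 * ∑ p ∈ CF, ((N : ℝ) - (unitaryFundamentalRep (Fin N) ℂ
        (plaquetteHolonomy V p.1 p.2.1.1 p.2.1.2)).trace.re)) *
        ‖(wilsonDirac (unitaryFundamentalRep (Fin N) ℂ)
            (fun e : Edge 4 (2 * M) => if (e.1 e.2).val + 1 = 2 * M then
              (-1 : Matrix.unitaryGroup (Fin N) ℂ) else 1) m 1).det‖) :
    ‖dAP W‖ ≤ Real.exp (K - cg / 4 * (((2 * M : ℕ) : ℝ) ^ 4 / 4) * ∑ p ∈ CF, dfc V p) * ‖dAP 1‖ := by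
  rw [hdAP W, apDet_one hdAP]
  exact glue_ineq_norm (Finset.sum_congr rfl fun p _ => (hdfc V p).symm) h

end CellGainTilingGlue

/-- **Sub-goal `stub_cellGainTilingGlueAllN` (G4 port, wave 12) — `cellGainTilingGlue` for `Fin N`,
pointwise, `K` tracked.**  For all `K cg : ℝ`, all `N M` (torus `(ℤ/2M)⁴`), every mass `m`, the crux's
`dAP` and `dfc` given by their defining equations, all `U(N)` fields `W V` and every plaquette Finset
`CF`: the tiling-currency gain `‖det D_AP[W]‖ ≤ exp(K − cg M⁴ Σ_{p ∈ CF} (N − Re tr V_p)) ‖det D_AP[𝟙]‖`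
implies the crux-currency gain `‖dAP W‖ ≤ exp(K − (cg/4) ((2M)⁴/4) Σ_{p ∈ CF} dfc V p) ‖dAP 1‖` — the
SAME `K` (in the crux `K = 0`) and rate `cg/4` against `L⁴/4`, `L = 2M`. -/
theorem stub_cellGainTilingGlueAllN : ∀ (K cg : ℝ) (N M : ℕ) [NeZero M] (m : ℝ) (dAP : GaugeConfig 4 (2 * M) (Matrix.unitaryGroup (Fin N) ℂ) → ℂ) (dfc : GaugeConfig 4 (2 * M) (Matrix.unitaryGroup (Fin N) ℂ) → Plaquette 4 (2 * M) → ℝ), (∀ V, dAP V = (wilsonDirac (unitaryFundamentalRep (Fin N) ℂ) (fun e => if (e.1 e.2).val + 1 = 2 * M then -V e else V e) m 1).det) → (∀ (V : GaugeConfig 4 (2 * M) (Matrix.unitaryGroup (Fin N) ℂ)) (p : Plaquette 4 (2 * M)), dfc V p = (N : ℝ) - (unitaryFundamentalRep (Fin N) ℂ (plaquetteHolonomy V p.1 p.2.1.1 p.2.1.2)).trace.re) → ∀ (W V : GaugeConfig 4 (2 * M) (Matrix.unitaryGroup (Fin N) ℂ)) (CF : Finset (Plaquette 4 (2 * M))),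 ‖(wilsonDirac (unitaryFundamentalRep (Fin N) ℂ) (fun e => if (e.1 e.2).val + 1 = 2 * M then -(W e) else W e) m 1).det‖ ≤ Real.exp (K - cg * (M : ℝ) ^ 4 * ∑ p ∈ CF, ((N : ℝ) - (unitaryFundamentalRep (Fin N) ℂ (plaquetteHolonomy V p.1 p.2.1.1 p.2.1.2)).trace.re)) * ‖(wilsonDirac (unitaryFundamentalRep (Fin N) ℂ) (fun e : Edge 4 (2 * M) => if (e.1 e.2).val + 1 = 2 * M then (-1 : Matrix.unitaryGroup (Fin N) ℂ) else 1) m 1).det‖ → ‖dAP W‖ ≤ Real.exp (K - cg / 4 * (((2 * M : ℕ) : ℝ) ^ 4 / 4) * ∑ p ∈ CF, dfc V p) * ‖dAP 1‖ := by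
  intro K cg N M _ m dAP dfc hdAP hdfc W V CF h
  exact CellGainTilingGlue.glue hdAP hdfc W V CF h

end Summit.QuantumFields.QCD.Cruxes.FlatCellOptimal.CellGain

end
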